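import Literature.Barriers.FinalStateConjecture.NonSmoothNullInfinityLogExpansion
import Literature.Barriers.FinalStateConjecture.NonSmoothNullInfinityUDecayTower
import HarnessLib

/-!
# Barrier catalogue `FinalStateConjecture`: compactly supported scattering data on `𝓘⁻` never give a
# conformally smooth `𝓘⁺` — discharge of `KehrbergerLogarithmicAsymptoticsCorrected`
(`Literature/Barriers/FinalStateConjecture/`, D-0021, D-0014; namespace
`Literature.Barriers.FinalStateConjecture`)

`NonSmoothNullInfinity.lean` vendors Kehrberger's Thm. 6.2 with Thm. 6.1 ("The case against smooth
null infinity I", Ann. Henri Poincaré 23 (2022) = arXiv:2105.08079, **v3** sign of the logarithmic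
term) as the named fact `KehrbergerLogarithmicAsymptoticsCorrected`, and
`NonSmoothNullInfinityScattering.lean` proves the reduction
`KehrbergerLogarithmicAsymptoticsCorrected.of_facts` to three analytic facts about the linear
scattering problem `∂ᵤ∂ᵥψ = −2M(1 − 2M/r)ψ/r³` on the Schwarzschild exterior with compactly supported
data on `𝓘⁻`. All three are now theorems:

* `SchwarzschildLinearScattering_exists_holds` (`NonSmoothNullInfinityExistence.lean`): existence of
  the smooth scattering solution (fixed point of the doubly integrated equation);
* `SchwarzschildLinearScattering_uDecay_holds` (`NonSmoothNullInfinityUDecayTower.lean`): the decay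
  (6.17), `|ψ + I⁽ⁿ⁾[G](n+1)!/|u|^{2+n}| ≤ C log|u|/|u|^{3+n}`, by the time-integral induction of the
  proof of Thm. 6.2 carried for all `∂ᵤ`-derivatives;
* `SchwarzschildLinearScattering_logExpansion_holds` (`NonSmoothNullInfinityLogExpansion.lean`): the
  expansion (6.18) of `∂ᵥψ` towards `𝓘⁺` with the logarithmic term
  `−(−1)ⁿ(n+3)! I⁽ⁿ⁾[G] M (log r − log|u|)/r^{4+n}` and all `v`-derivatives, by the same induction
  (base: the explicit evaluation of `∫_{−∞}^{u} Vψ du'`, where the logarithm arises from the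
  `|u'|⁻²`-tail of `ψ(u', ∞)` integrated against `1/r(u',v)³`, §2.1 eq. (2.15)).

Hence `KehrbergerLogarithmicAsymptoticsCorrected_holds`. (The uniqueness and time-integral facts used
on the way, `SchwarzschildLinearScattering_unique_holds` and `…_timeIntegral_holds`, are theorems of
`NonSmoothNullInfinityScatteringProofs.lean`.)

## References

* L. M. A. Kehrberger, *The case against smooth null infinity I: heuristics and counter-examples*,
  Ann. Henri Poincaré 23 (2022) 829–921 = arXiv:2105.08079 (v3, 2023: "sign mistake in eqns. (4.45),
  (6.5), (6.18), and (B.2) fixed"), Thm. 6.1, Thm. 6.2 eqs. (6.17)–(6.18). Key `Kehrberger2022AHP`.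
-/

noncomputable section

namespace Literature.Barriers.FinalStateConjecture

/-- **Discharge of `KehrbergerLogarithmicAsymptoticsCorrected`** (Kehrberger, arXiv:2105.08079v3,
Thm. 6.2 with Thm. 6.1, logarithmic coefficient with the corrected (v3) sign
`−(−1)ⁿ(3+n)! I⁽ⁿ⁾[G] M`): from the proved reduction
`KehrbergerLogarithmicAsymptoticsCorrected.of_facts` and the three discharged analytic facts
(existence of the scattering solution, the decay (6.17), the expansion (6.18)).
[cite: Kehrberger2022AHP, Thm. 6.2 eqs. (6.17)–(6.18) (arXiv v3) and Thm. 6.1] -/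
theorem KehrbergerLogarithmicAsymptoticsCorrected_holds : KehrbergerLogarithmicAsymptoticsCorrected :=
  KehrbergerLogarithmicAsymptoticsCorrected.of_facts SchwarzschildLinearScattering_exists_holds
    SchwarzschildLinearScattering_uDecay_holds SchwarzschildLinearScattering_logExpansion_holds

end Literature.Barriers.FinalStateConjecture

end
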